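import Summits.BirchSwinnertonDyer.Rank1Residual.Partition.CornersAll
import Summits.BirchSwinnertonDyer.Rank1Residual.Partition.CornersFiveLeTargetA
import Summits.BirchSwinnertonDyer.Rank1Residual.X2.ClassClosureEntireFree
import HarnessLib

/-!
# The corner forms WITHOUT the binder `hmod` (cell `b2b-bsdres`, seat rmap-1 gen 10;
# RESIDUAL-MAP.md §A / §C, §I HEADLINE; kernel 10 of the seat)

HONEST FRAMING (run/shared/lean/b2b/bsd-rank1-residual/, verbatim in every file): the goal of the
cell is to DELETE the COMBINATION-SHAPED residual classes of the Birch–Swinnerton-Dyer formula for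
ALL analytic-rank `≤ 1` elliptic curves over `ℚ` — "full BSD formula for every rank `≤ 1` curve in
class `C`" assembled STRICTLY from published theorems — so that the rank-`≤ 1` remainder becomes
exactly the CONSTRUCTION-SHAPED classes, which are TYPED (missing-input `Prop`s), NOT attempted.
This is not "finishing BSD". Research routes; no claim beyond the stated classes; nothing booked;
no label changes. THEOREMS ONLY (no definition, no named fact, no `sorry`); every published theorem
enters as one of the tree's existing named Literature facts BY NAME.

## What this file records

Every closing form of `Partition/` so far binds BOTH `hmod : hasEntireLFunction_rat` ("`L(E, s)` is
entire for every `E/ℚ`") AND `hmodP : nonempty_modularParametrizationData` (a modular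
parametrisation datum for every `E/ℚ`, [BCDTJAMS2001] Theorem A). Since
`X2.ClassClosureEntireFree.hasEntireLFunction_rat_of_nonempty_modularParametrizationData`
(eisenstein-p2, from `exists_isNewformOf_of_nonempty_modularParametrizationData` and
`hasEntireLFunction_rat_of_exists_isNewformOf`, [DiamondShurman2005] Thm. 5.10.2) the first is a
THEOREM given the second, so `hmod` is REDUNDANT in every such statement. This file restates the
three statements of record of the seat's blocks with `hmod` DISCHARGED — one named fact fewer in
each, proofs = the originals fed with the derived `hmod`:

* `bsdp_of_not_corner_entireFree` — `Corners.bsdp_of_not_corner` (RESIDUAL-MAP §A/§B/§C corner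
  predicates: non-CM, odd `p`, good or multiplicative-with-`r = 0`; THIRTEEN named facts instead of
  fourteen);
* `bsdp_allCurves_of_not_corner_of_not_cornerF_entireFree` —
  `CornersAll.bsdp_allCurves_of_not_corner_of_not_cornerF` (the §I HEADLINE kernel form, CM axis
  folded in; THIRTEEN named facts);
* `bsdp_goodOrd_or_mult_of_five_le_rankLeOne_certificates_targetA_entireFree` —
  `CornersFiveLeTargetA.bsdp_goodOrd_or_mult_of_five_le_rankLeOne_certificates_targetA` (the
  TWELFTH joint §A/§C form at `p ≥ 5` modulo the per-pair certificate binders and the two X2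
  closure terms; TWENTY-EIGHT named facts instead of twenty-nine), with its partition form.

Nothing else changes: hypotheses, case splits and conclusions are the originals'; no class, mark,
tier or number of RESIDUAL-MAP.md is touched by this file.

References: RESIDUAL-MAP.md §A / §C / §I (SIGNED-FINAL 2026-08-21T15:00Z) and the seat's POST-FINAL
notes; `Partition/Corners.lean` (rmap-1 gen 2), `Partition/CornersAll.lean`,
`Partition/CornersFiveLeTargetA.lean` (p300504), `X2/ClassClosureEntireFree.lean`;
[BCDTJAMS2001] Theorem A; [DiamondShurman2005] Thm. 5.10.2, Thm. 8.8.3.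
-/

noncomputable section

open scoped Classical MatrixGroups ModularForm NumberField

namespace Summit.BirchSwinnertonDyer.Rank1Residual

open CongruenceSubgroup WeierstrassCurve PowerSeries Literature.NumberTheory.EllipticCurves
  Literature.NumberTheory.EllipticCurves.Rank1Residual
  Literature.NumberTheory.EllipticCurves.ModularForms
  Literature.NumberTheory.EllipticCurves.Wuthrich2014
  Literature.NumberTheory.EllipticCurves.GreenbergVatsal2000
  Literature.NumberTheory.EllipticCurves.Rank1Residual.Typed
  Literature.NumberTheory.EllipticCurves.Skinner2016
  Literature.NumberTheory.EllipticCurves.SteinWuthrich2013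
  Literature.NumberTheory.EllipticCurves.Disegni2020
  Literature.NumberTheory.EllipticCurves.EmertonPollackWeston2006
  X2.ClassClosureEntireFree

section Curve

variable {W : WeierstrassCurve ℚ} [W.IsElliptic] [W.IsGloballyMinimal] {p : ℕ} [Fact p.Prime]

/-! ### §1. The corner predicate forms without `hmod` -/

/-- **RESIDUAL-MAP §A/§B/§C corner predicates, `hmod` discharged: THIRTEEN named facts.** For a
non-CM `E/ℚ` of analytic rank `≤ 1` and an odd prime `p` that is good, or multiplicative with
`r = 0`, `BSD(E,p)` holds outside the eight named corners — `Corners.bsdp_of_not_corner` with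
`hmod := hasEntireLFunction_rat_of_nonempty_modularParametrizationData hmodP`. [folklore] -/
theorem bsdp_of_not_corner_entireFree (hSk : Skinner2016.thmC_padicValRat_bsd_rank_zero)
    (hBCS : BurungaleCastellaSkinner2025.cor131_padicValRat_bsd_rank_le_one)
    (hJSW : JetchevSkinnerWan2017.thm121_padicValRat_bsd_rank_one)
    (hCGS : CastellaGrossiSkinner2025.thmD_padicValRat_bsd_rank_le_one)
    (hGV : GreenbergVatsal2000.thm13_charIdeal_eq_of_gvPar) (hGr : greenberg_charValue_rankZero)
    (hmodP : nonempty_modularParametrizationData)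
    (hGZK : rank_eq_analyticRank_of_analyticRank_le_one)
    (hCM : bsdTriple_of_hasCM_of_L_one_ne_zero) (hKob : Kobayashi2013.cor14_bsdp_of_cm_rank_one)
    (hYZ : YanZhu2026.thm415_padicValRat_bsd_rank_le_one)
    (hW20 : Wuthrich2014.lemma20_surjective_threeAdic_of_semistable)
    (hLLT : LiLiuTian2024.thm11_bsdp_of_cm_rank_one)
    (hr : W.analyticRank ≤ 1) (hcm : ¬ W.HasCM) (hp : p ≠ 2)
    (hdom : Good W p ∨ (Mult W p ∧ W.analyticRank = 0))
    (hX1 : ¬ ClassX1 W p) (hX9 : ¬ ClassX9 W p) (hX10b : ¬ (ClassX10 W p ∧ ¬ Surj W p))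
    (hX6 : ¬ (ClassX6 W p ∧ W.analyticRank = 0)) (hX7 : ¬ ClassX7 W p) (hX8 : ¬ ClassX8 W p)
    (hX11a : ¬ ClassX11a W p) (hX2 : ¬ ClassX2 W p) : BSDp W p :=
  bsdp_of_not_corner hSk hBCS hJSW hCGS hGV hGr
    (hasEntireLFunction_rat_of_nonempty_modularParametrizationData hmodP) hmodP hGZK hCM hKob hYZ
    hW20 hLLT hr hcm hp hdom hX1 hX9 hX10b hX6 hX7 hX8 hX11a hX2

/-- **The §I HEADLINE kernel form for ALL curves, `hmod` discharged: THIRTEEN named facts.** For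
every `E/ℚ` of analytic rank `≤ 1` and every prime `p` in the domain "`p` odd and (good, or
multiplicative with `r = 0`)" or "`E` has CM", `BSD(E,p)` holds outside the eight non-CM corners
and outside `CornerF` — `CornersAll.bsdp_allCurves_of_not_corner_of_not_cornerF` with
`hmod := hasEntireLFunction_rat_of_nonempty_modularParametrizationData hmodP`. [folklore] -/
theorem bsdp_allCurves_of_not_corner_of_not_cornerF_entireFree
    (hSk : Skinner2016.thmC_padicValRat_bsd_rank_zero)
    (hBCS : BurungaleCastellaSkinner2025.cor131_padicValRat_bsd_rank_le_one)
    (hJSW : JetchevSkinnerWan2017.thm121_padicValRat_bsd_rank_one)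
    (hCGS : CastellaGrossiSkinner2025.thmD_padicValRat_bsd_rank_le_one)
    (hGV : GreenbergVatsal2000.thm13_charIdeal_eq_of_gvPar) (hGr : greenberg_charValue_rankZero)
    (hmodP : nonempty_modularParametrizationData)
    (hGZK : rank_eq_analyticRank_of_analyticRank_le_one)
    (hCM : bsdTriple_of_hasCM_of_L_one_ne_zero) (hKob : Kobayashi2013.cor14_bsdp_of_cm_rank_one)
    (hYZ : YanZhu2026.thm415_padicValRat_bsd_rank_le_one)
    (hW20 : Wuthrich2014.lemma20_surjective_threeAdic_of_semistable)
    (hLLT : LiLiuTian2024.thm11_bsdp_of_cm_rank_one)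
    (hr : W.analyticRank ≤ 1)
    (hdom : W.HasCM ∨ (p ≠ 2 ∧ (Good W p ∨ (Mult W p ∧ W.analyticRank = 0))))
    (hA : ¬ W.HasCM → ¬ ClassX1 W p ∧ ¬ ClassX9 W p ∧ ¬ (ClassX10 W p ∧ ¬ Surj W p) ∧
      ¬ (ClassX6 W p ∧ W.analyticRank = 0) ∧ ¬ ClassX7 W p ∧ ¬ ClassX8 W p ∧
      ¬ ClassX11a W p ∧ ¬ ClassX2 W p)
    (hF : W.HasCM → ¬ CornerF W p) : BSDp W p :=
  bsdp_allCurves_of_not_corner_of_not_cornerF hSk hBCS hJSW hCGS hGV hGr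
    (hasEntireLFunction_rat_of_nonempty_modularParametrizationData hmodP) hmodP hGZK hCM hKob hYZ
    hW20 hLLT hr hdom hA hF

/-! ### §2. The TWELFTH joint form at `p ≥ 5` without `hmod` -/

/-- **Non-CM, `p ≥ 5`, 'good ORDINARY, or MULTIPLICATIVE', analytic rank `≤ 1`, modulo the per-pair
certificate binders of record and the TWO X2 closure terms, `hmod` discharged: TWENTY-EIGHT named
facts.** Statement and conclusion of
`CornersFiveLeTargetA.bsdp_goodOrd_or_mult_of_five_le_rankLeOne_certificates_targetA` verbatim
except that the binder `hmod : hasEntireLFunction_rat` is absent (derived inside from `hmodP`).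
[folklore] -/
theorem bsdp_goodOrd_or_mult_of_five_le_rankLeOne_certificates_targetA_entireFree
    (hBCS : BurungaleCastellaSkinner2025.cor131_padicValRat_bsd_rank_le_one)
    (hBCSa : burungale_castella_skinner_charIdeal_eq_padicLFunction)
    (hGZK : rank_eq_analyticRank_of_analyticRank_le_one)
    (hCGS : CastellaGrossiSkinner2025.thmD_padicValRat_bsd_rank_le_one)
    (hGVg : GreenbergVatsal2000.thm13_charIdeal_eq_of_gvPar) (hGr : greenberg_charValue_rankZero)
    (hmodP : nonempty_modularParametrizationData)
    (hS : Schneider1985_order_charGenerator) (hPR : perrinRiou_rankOne_leadingTerms)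
    (hΩ : realPeriodRat_eq_unit_mul_plusPeriod)
    (hSk : Skinner2016.thmC_padicValRat_bsd_rank_zero) (hA : thmA_charIdeal_multiplicative)
    (hD : thm1_padicBSD_rankOne_multiplicative)
    (hWu : thm16_charIdeal_dvd_multiplicative_of_reducible)
    (hJs : thm61_splitMultiplicative) (hJn : thm61_nonsplitMultiplicative)
    (hHs : exists_isSplitMultCanonical) (hHn : exists_isMultCanonical)
    (hGS : ∀ (W : WeierstrassCurve ℚ) [W.IsElliptic] [W.IsGloballyMinimal] (p : ℕ) [Fact p.Prime],
      greenberg_stevens (W := W) (p := p))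
    (hHida : hida_exists_congruent_ordinary_newform_of_multiplicative)
    (hMTT : exists_isCycPAdicLFunctionWeightK)
    (h311e : thm311_cotorsion_weightK_member) (hT1a : thm1_muAlg_of_weightK_member)
    (hT2 : Wan2015.thm4_rational_weightK_member_of_bdd)
    (hT1b : thm513_transfer_from_weightK_member_of_bdd)
    (h61 : DeligneSerre1974.thm61_exists_adicGaloisRep) (h326 : Hida2000_thm326_ordinary)
    (hKato : kato_charIdeal_dvd_multiplicative_of_surjective)
    (hGV : lambdaMu_multiplicative_of_gvPar) (hTA : X2.TargetA)
    (hcm : ¬ W.HasCM) (hr : W.analyticRank ≤ 1) (h5 : 5 ≤ p) (hdom : GoodOrd W p ∨ Mult W p)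
    (hcert1 : ClassX1 W p → GVPar W p →
      ∃ (N : ℕ) (_ : NeZero N) (f : CuspForm (Gamma0 N) 2), IsNewformOf W f ∧
        ∃ n : ℕ, (p : ℝ) ^ (-n : ℤ) < ‖padicLRiemannSum f (unitRoot W p : ℚ_[p]) 1 n‖)
    (hμ9 : ClassX9 W p → ∀ (κ : ZpExtension ℚ p) (γ : Field.absoluteGaloisGroup ℚ),
        κ.IsCyclotomic → κ.IsTopGenerator γ → IsCyclotomicVariable p γ →
      ∀ (D : W.SelmerDualData κ γ), D.mu = 0)
    (hcert9 : ClassX9 W p → ∀ [NeZero (W.conductorNorm ℤ)]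
        (f : CuspForm (CongruenceSubgroup.Gamma0 (W.conductorNorm ℤ)) 2),
        IsNewformOf W f → ∀ (ϖ : ℚ), (ϖ : ℝ) * W.realPeriodRat = plusPeriod f →
      ∃ n : ℕ, ‖PowerSeries.coeff n
        (PowerSeries.C (ϖ : ℚ_[p]) * padicLFunction f (unitRoot W p : ℚ_[p]))‖ = 1)
    (hSch9 : ClassX9 W p → ∀ Dh : PAdicHeightData W p, Dh.IsCanonical → SchneiderConjecture Dh)
    (hSchN : ∀ (q : ℚ_[p]) (Dh : PAdicHeightData W p), q ≠ 0 → ‖q‖ < 1 → tateJ q = (W.j : ℚ_[p]) →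
      IsMultCanonical Dh q → SchneiderConjecture Dh)
    (hSchS : ∀ (Dq : TateParameterData W p) (Dh : PAdicHeightData W p),
      IsSplitMultCanonical Dh Dq → SchneiderConjecture Dh)
    (hμ11 : ClassX11a W p ∨ (ClassX11b W p ∧ ¬ Ram W p) → Surj W p → X11a.MuAnZeroAt W p)
    (hA1 : ¬ (ClassX1 W p ∧ ¬ GVPar W p)) (hX11a : ¬ (ClassX11a W p ∧ ¬ Surj W p))
    (hX2 : ¬ (ClassX2 W p ∧ ¬ (W.analyticRank = 0 ∧ GVPar W p) ∧
      ¬ (W.analyticRank = 1 ∧ ¬ W.HasSplitMultiplicativeReductionAtPrime p ∧ GVPar W p)))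
    (hX11b : ¬ (ClassX11b W p ∧ ¬ Ram W p ∧ (¬ Surj W p ∨
      (W.HasSplitMultiplicativeReductionAtPrime p ∧
        ¬ ∃ (m : ℕ) (_ : Fact m.Prime), m ≠ p ∧ W.HasMultiplicativeReductionAtPrime m)))) :
    BSDp W p :=
  bsdp_goodOrd_or_mult_of_five_le_rankLeOne_certificates_targetA hBCS hBCSa hGZK hCGS hGVg hGr
    (hasEntireLFunction_rat_of_nonempty_modularParametrizationData hmodP) hmodP hS hPR hΩ hSk hA hD
    hWu hJs hJn hHs hHn hGS hHida hMTT h311e hT1a hT2 hT1b h61 h326 hKato hGV hTA hcm hr h5 hdom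
    hcert1 hμ9 hcert9 hSch9 hSchN hSchS hμ11 hA1 hX11a hX2 hX11b

/-- **Partition form, `p ≥ 5`, 'good ORDINARY, or MULTIPLICATIVE', rank `≤ 1`, `hmod` discharged**
— `CornersFiveLeTargetA.bsdp_or_corner_goodOrd_or_mult_of_five_le_certificates_targetA` from the
same TWENTY-EIGHT named facts, `hGV` / `hTA`, and per-pair hypotheses. [folklore] -/
theorem bsdp_or_corner_goodOrd_or_mult_of_five_le_certificates_targetA_entireFree
    (hBCS : BurungaleCastellaSkinner2025.cor131_padicValRat_bsd_rank_le_one)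
    (hBCSa : burungale_castella_skinner_charIdeal_eq_padicLFunction)
    (hGZK : rank_eq_analyticRank_of_analyticRank_le_one)
    (hCGS : CastellaGrossiSkinner2025.thmD_padicValRat_bsd_rank_le_one)
    (hGVg : GreenbergVatsal2000.thm13_charIdeal_eq_of_gvPar) (hGr : greenberg_charValue_rankZero)
    (hmodP : nonempty_modularParametrizationData)
    (hS : Schneider1985_order_charGenerator) (hPR : perrinRiou_rankOne_leadingTerms)
    (hΩ : realPeriodRat_eq_unit_mul_plusPeriod)
    (hSk : Skinner2016.thmC_padicValRat_bsd_rank_zero) (hA : thmA_charIdeal_multiplicative)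
    (hD : thm1_padicBSD_rankOne_multiplicative)
    (hWu : thm16_charIdeal_dvd_multiplicative_of_reducible)
    (hJs : thm61_splitMultiplicative) (hJn : thm61_nonsplitMultiplicative)
    (hHs : exists_isSplitMultCanonical) (hHn : exists_isMultCanonical)
    (hGS : ∀ (W : WeierstrassCurve ℚ) [W.IsElliptic] [W.IsGloballyMinimal] (p : ℕ) [Fact p.Prime],
      greenberg_stevens (W := W) (p := p))
    (hHida : hida_exists_congruent_ordinary_newform_of_multiplicative)
    (hMTT : exists_isCycPAdicLFunctionWeightK)
    (h311e : thm311_cotorsion_weightK_member) (hT1a : thm1_muAlg_of_weightK_member)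
    (hT2 : Wan2015.thm4_rational_weightK_member_of_bdd)
    (hT1b : thm513_transfer_from_weightK_member_of_bdd)
    (h61 : DeligneSerre1974.thm61_exists_adicGaloisRep) (h326 : Hida2000_thm326_ordinary)
    (hKato : kato_charIdeal_dvd_multiplicative_of_surjective)
    (hGV : lambdaMu_multiplicative_of_gvPar) (hTA : X2.TargetA)
    (hcm : ¬ W.HasCM) (hr : W.analyticRank ≤ 1) (h5 : 5 ≤ p) (hdom : GoodOrd W p ∨ Mult W p)
    (hcert1 : ClassX1 W p → GVPar W p →
      ∃ (N : ℕ) (_ : NeZero N) (f : CuspForm (Gamma0 N) 2), IsNewformOf W f ∧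
        ∃ n : ℕ, (p : ℝ) ^ (-n : ℤ) < ‖padicLRiemannSum f (unitRoot W p : ℚ_[p]) 1 n‖)
    (hμ9 : ClassX9 W p → ∀ (κ : ZpExtension ℚ p) (γ : Field.absoluteGaloisGroup ℚ),
        κ.IsCyclotomic → κ.IsTopGenerator γ → IsCyclotomicVariable p γ →
      ∀ (D : W.SelmerDualData κ γ), D.mu = 0)
    (hcert9 : ClassX9 W p → ∀ [NeZero (W.conductorNorm ℤ)]
        (f : CuspForm (CongruenceSubgroup.Gamma0 (W.conductorNorm ℤ)) 2),
        IsNewformOf W f → ∀ (ϖ : ℚ), (ϖ : ℝ) * W.realPeriodRat = plusPeriod f →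
      ∃ n : ℕ, ‖PowerSeries.coeff n
        (PowerSeries.C (ϖ : ℚ_[p]) * padicLFunction f (unitRoot W p : ℚ_[p]))‖ = 1)
    (hSch9 : ClassX9 W p → ∀ Dh : PAdicHeightData W p, Dh.IsCanonical → SchneiderConjecture Dh)
    (hSchN : ∀ (q : ℚ_[p]) (Dh : PAdicHeightData W p), q ≠ 0 → ‖q‖ < 1 → tateJ q = (W.j : ℚ_[p]) →
      IsMultCanonical Dh q → SchneiderConjecture Dh)
    (hSchS : ∀ (Dq : TateParameterData W p) (Dh : PAdicHeightData W p),
      IsSplitMultCanonical Dh Dq → SchneiderConjecture Dh)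
    (hμ11 : ClassX11a W p ∨ (ClassX11b W p ∧ ¬ Ram W p) → Surj W p → X11a.MuAnZeroAt W p) :
    BSDp W p ∨ (ClassX1 W p ∧ ¬ GVPar W p) ∨ (ClassX11a W p ∧ ¬ Surj W p) ∨
      (ClassX2 W p ∧ ¬ (W.analyticRank = 0 ∧ GVPar W p) ∧
        ¬ (W.analyticRank = 1 ∧ ¬ W.HasSplitMultiplicativeReductionAtPrime p ∧ GVPar W p)) ∨
      (ClassX11b W p ∧ ¬ Ram W p ∧ (¬ Surj W p ∨
        (W.HasSplitMultiplicativeReductionAtPrime p ∧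
          ¬ ∃ (m : ℕ) (_ : Fact m.Prime), m ≠ p ∧ W.HasMultiplicativeReductionAtPrime m))) :=
  bsdp_or_corner_goodOrd_or_mult_of_five_le_certificates_targetA hBCS hBCSa hGZK hCGS hGVg hGr
    (hasEntireLFunction_rat_of_nonempty_modularParametrizationData hmodP) hmodP hS hPR hΩ hSk hA hD
    hWu hJs hJn hHs hHn hGS hHida hMTT h311e hT1a hT2 hT1b h61 h326 hKato hGV hTA hcm hr h5 hdom
    hcert1 hμ9 hcert9 hSch9 hSchN hSchS hμ11

end Curve

end Summit.BirchSwinnertonDyer.Rank1Residual
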